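import Summits.CriticalPhenomena.PercolationContinuityZ3.Theorems.PercNearOneGluingNoHeavyLowerTailSahiTwoChainWRStaircase
import HarnessLib

/-!
# The Lieb–Sahi induction for `Ẽ_n`, II: the extremal argument, the induction, and the main theorem

Support file of the one-cut programme (crux `NoHeavyLowerTail`, stmt-CriticalPhenomena-4575; cell `prim-masterthm`, seat P3, gen 16;
`run/shared/lean/prim/prim-masterthm/prim-masterthm-p3/HIERARCHY.md` §24; memo
`run/shared/lean/prim/prim-masterthm/FROM-prim-masterthm-p3-g16-TWO-CHAIN-COEFFICIENTS.md`).

Continuation of `…SahiTwoChainWRStaircase`: 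
* `et_const_stairs_nonneg` — the chain case (constant sequences = nested full-width bands; any slot order) via `et_eq_chainAvg`;
* `et_stairPos_of_disjointNonpos` — `B(n) ⟹ C(n)`, Lieb–Sahi's extremal argument [LiebSahi2021, Thm. 3.13] verbatim for `Ẽ`;
* `et_disjointNonpos_and_stairPos`, **`et_stairs_nonneg`** — the joint induction over all grid sizes: `Ẽ_n ≥ 0` for every family of
  staircase indicators of `Fin m × Fin m`, `n ≤ m`;
* transport to down-sets, up-sets (reflection) and, by the finite layer cake, **`et_nonneg_of_monotone`**: `Ẽ_n(f_0,…,f_{n−1}) ≥ 0`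
  for all nonnegative monotone `f_i` on `Fin m × Fin m`, `n ≤ m` — the main theorem; its meaning for Sahi's `E_n` (coefficientwise
  Lieb–Sahi in two dimensions) is derived in `…SahiTwoChainWRCoefficients`.
Everything PROVED, standard axioms; no new definitions. [this work]
-/

noncomputable section

open scoped Classical

namespace Summit.CriticalPhenomena.PercolationContinuityZ3.Theorems

open Finset Function
open Literature.Combinatorics.Sahi2008

namespace SahiTwoChain

/-! ## The Lieb–Sahi induction for `Ẽ_n`, continued -/

section Grid

open Literature.Combinatorics.Sahi2008.LiebSahiGrid

variable {m : ℕ}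

/-- Replacing the sequence in slot `k` replaces the indicator in slot `k` (plumbing). [this work] -/
private theorem setInd_stairSet_update' {n : ℕ} (x : Fin n → Fin m → ℕ) (k : Fin n) (z : Fin m → ℕ) :
    (fun i => setInd (stairSet (update x k z i))) =
      update (fun i => setInd (stairSet (x i))) k (setInd (stairSet z)) := by
  funext i
  exact apply_update (fun _ (y : Fin m → ℕ) => setInd (stairSet y)) x k z i

/-- A family with one sequence replaced by a staircase is a family of staircases (plumbing). [this work] -/
private theorem isStair_update' {n : ℕ} {x : Fin n → Fin m → ℕ} (hx : ∀ i, IsStair m (x i)) (k : Fin n)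
    {z : Fin m → ℕ} (hz : IsStair m z) (i : Fin n) : IsStair m (update x k z i) := by
  by_cases hi : i = k
  · subst hi
    rw [update_self]
    exact hz
  · rw [update_of_ne hi]
    exact hx i

/-- `λ = Σ S(a^i)` after replacing slot `k` (plumbing). [this work] -/
private theorem sum_S_update' {n : ℕ} (x : Fin n → Fin m → ℕ) (k : Fin n) (z : Fin m → ℕ) :
    ∑ i, S (update x k z i) = ∑ i, S (x i) + (S z - S (x k)) := by
  have h : ∑ i, (S (update x k z i) - S (x i)) = S z - S (x k) := by
    rw [Finset.sum_eq_single k]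
    · rw [update_self]
    · intro j _ hjk
      rw [update_of_ne hjk, sub_self]
    · intro hk
      exact absurd (mem_univ k) hk
  rw [sum_sub_distrib] at h
  linarith

open Classical in
/-- `𝒜(m)` as a finite set (plumbing for the extremal argument). [this work] -/
private theorem mem_stairFinset' {a : Fin m → ℕ} :
    a ∈ (Fintype.piFinset fun _ : Fin m => Finset.range (m + 1)).filter (IsStair m) ↔ IsStair m a := by
  rw [Finset.mem_filter, Fintype.mem_piFinset]
  constructor
  · exact fun h => h.2
  · exact fun h => ⟨fun i => Finset.mem_range.2 (Nat.lt_succ_of_le (h.2 i)), h⟩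

/-! ### The chain case: constant sequences -/

/-- A constant-sequence staircase is a full-width band: its indicator is a function of the row only. [this work] -/
theorem setInd_stairSet_const (c : ℕ) :
    setInd (stairSet (fun _ : Fin m => c)) = (fun y : Fin m => if (y : ℕ) < c then (1 : ℝ) else 0) ∘ Prod.snd := by
  funext z
  simp only [setInd_apply, mem_stairSet, Function.comp_apply]

/-- **`Ẽ_n ≥ 0` for nested full-width bands** (constant sequences, any slot order, `n ≤ m`): sort the slots so that the bands
decrease, then `Ẽ_n = chainAvg ≥ 0` (`et_eq_chainAvg`, `chainAvg_nonneg`). [this work] -/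
theorem et_const_stairs_nonneg {n : ℕ} (hn : n ≤ m) (c : Fin n → ℕ) :
    0 ≤ et univ univ n (fun i => setInd (stairSet (fun _ : Fin m => c i))) := by
  -- sort: `c ∘ σ` antitone
  let σ : Equiv.Perm (Fin n) := Fin.revPerm.trans (Tuple.sort c)
  have hanti : Antitone (c ∘ σ) := by
    intro i j hij
    show c (Tuple.sort c (Fin.rev j)) ≤ c (Tuple.sort c (Fin.rev i))
    exact Tuple.monotone_sort c (Fin.rev_le_rev.2 hij)
  rw [← et_comp_perm n univ univ σ]
  set g : Fin n → Fin m → ℝ := fun i y => if (y : ℕ) < c (σ i) then 1 else 0 with hg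
  have hfam : (fun i => (fun i => setInd (stairSet (fun _ : Fin m => c i))) (σ i)) = fun i => g i ∘ Prod.snd := by
    funext i
    exact setInd_stairSet_const (c (σ i))
  rw [hfam]
  have habs : ∀ i j : Fin n, i < j → g j * g i = g j := by
    intro i j hij
    have hc : c (σ j) ≤ c (σ i) := hanti hij.le
    funext y
    simp only [hg, Pi.mul_apply]
    by_cases hy : (y : ℕ) < c (σ j)
    · simp [hy, lt_of_lt_of_le hy hc]
    · simp [hy]
  rw [et_eq_chainAvg n univ univ g habs (by simpa using hn) (by simpa using hn)]
  refine chainAvg_nonneg n univ g (fun i y _ => ?_) (fun i y _ => ?_)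
  · simp only [hg]; split_ifs <;> norm_num
  · simp only [hg]; split_ifs <;> norm_num

/-! ### `B(n) ⟹ C(n)`: the extremal argument -/

/-- **The step `B(n) ⟹ C(n)` for `Ẽ`** (with `A(n)` on the same grid as input): Lieb–Sahi's extremal argument verbatim — among
the minimisers of `Ẽ_n` over `𝒜(m)^n` take one maximising `Σ S(a^i)`; a descent is impossible (Prop. 3.10 for `Ẽ`, or
Thm. 3.12 for `Ẽ`); so all sequences are constant and `Ẽ_n ≥ 0` by the chain case. [this work] -/
theorem et_stairPos_of_disjointNonpos (hm : 0 < m) {n : ℕ} (hn : n ≤ m)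
    (hA : ∀ (F : Fin n → Fin m × Fin m → ℝ) (s t : Fin n), s ≠ t → ∀ (b : Fin m → ℕ)
      (T : Finset (Fin m × Fin m)), n ≤ m → IsStair m b → Disjoint (stairSet b) T → F s = setInd (stairSet b) →
      F t = setInd T → (∀ i, i ≠ s → i ≠ t → ∃ a, IsStair m a ∧ F i = setInd (stairSet a)) →
      et univ univ n F ≤ 0)
    (a : Fin n → Fin m → ℕ) (ha : ∀ i, IsStair m (a i)) :
    0 ≤ et univ univ n (fun i => setInd (stairSet (a i))) := by
  set E : (Fin n → Fin m → ℕ) → ℝ := fun x => et univ univ n (fun i => setInd (stairSet (x i))) with hE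
  set Λ : (Fin n → Fin m → ℕ) → ℝ := fun x => ∑ i, S (x i) with hΛ
  set 𝒯 : Finset (Fin n → Fin m → ℕ) := Fintype.piFinset fun _ : Fin n =>
    (Fintype.piFinset fun _ : Fin m => Finset.range (m + 1)).filter (IsStair m) with h𝒯
  have hmem𝒯 : ∀ x, x ∈ 𝒯 ↔ ∀ i, IsStair m (x i) := by
    intro x
    simp only [h𝒯, Fintype.mem_piFinset, mem_stairFinset']
  have hne : 𝒯.Nonempty := ⟨a, (hmem𝒯 a).2 ha⟩
  obtain ⟨x₀, hx₀, hmin⟩ := 𝒯.exists_min_image E hne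
  set 𝒯' := 𝒯.filter (fun x => E x = E x₀) with h𝒯'
  have hne' : 𝒯'.Nonempty := ⟨x₀, by rw [h𝒯', Finset.mem_filter]; exact ⟨hx₀, rfl⟩⟩
  obtain ⟨x₁, hx₁, hmax⟩ := 𝒯'.exists_max_image Λ hne'
  rw [h𝒯', Finset.mem_filter] at hx₁
  obtain ⟨hx₁𝒯, hx₁E⟩ := hx₁
  have hx₁s : ∀ i, IsStair m (x₁ i) := (hmem𝒯 x₁).1 hx₁𝒯
  have hmin₁ : ∀ y, (∀ i, IsStair m (y i)) → E x₁ ≤ E y := fun y hy => by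
    rw [hx₁E]
    exact hmin y ((hmem𝒯 y).2 hy)
  have hmax₁ : ∀ y, (∀ i, IsStair m (y i)) → E y = E x₁ → Λ y ≤ Λ x₁ := fun y hy hyE =>
    hmax y (by rw [h𝒯', Finset.mem_filter]; exact ⟨(hmem𝒯 y).2 hy, hyE.trans hx₁E⟩)
  have hEupd : ∀ (l : Fin n) (z : Fin m → ℕ),
      E (update x₁ l z) = et univ univ n (update (fun i => setInd (stairSet (x₁ i))) l (setInd (stairSet z))) := by
    intro l z
    simp only [hE, setInd_stairSet_update']
  have hΛupd : ∀ (l : Fin n) (z : Fin m → ℕ), Λ (update x₁ l z) = Λ x₁ + (S z - S (x₁ l)) := by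
    intro l z
    simp only [hΛ, sum_S_update']
  have hstar : ∀ (j l : Fin n), j ≠ l → ∀ {p : ℕ} (hp : p + 1 < m), HasDescent (x₁ l) hp →
      x₁ j (ixR hp) ≤ x₁ l (ixR hp) → False := by
    intro j l hjl p hp hdl hle
    have hy : ∀ i, IsStair m (update x₁ l (aStar (x₁ l) hp) i) :=
      isStair_update' hx₁s l (isStair_aStar hp (hx₁s l) hdl)
    have hEy : E (update x₁ l (aStar (x₁ l) hp)) ≤ E x₁ := by
      rw [hEupd]
      exact et_update_aStar_le hn hA hx₁s hjl hp hle
    have hEy' : E (update x₁ l (aStar (x₁ l) hp)) = E x₁ := le_antisymm hEy (hmin₁ _ hy)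
    have hΛy := hmax₁ _ hy hEy'
    rw [hΛupd, S_aStar] at hΛy
    linarith
  have hnd : ∀ (l : Fin n) (p : ℕ) (hp : p + 1 < m), ¬ HasDescent (x₁ l) hp := by
    intro l p hp hdl
    by_cases hex : ∃ j, j ≠ l ∧ HasDescent (x₁ j) hp
    · obtain ⟨j, hjl, hdj⟩ := hex
      rcases le_total (x₁ j (ixR hp)) (x₁ l (ixR hp)) with hle | hle
      · exact hstar j l hjl hp hdl hle
      · exact hstar l j (Ne.symm hjl) hp hdj hle
    · push Not at hex
      have hflat : ∀ i, i ≠ l → x₁ i (ixL hp) = x₁ i (ixR hp) := fun i hi =>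
        eq_of_not_hasDescent (hx₁s i).1 hp (hex i hi)
      have havg := et_update_aPlus_add_aMinus l hp hflat (a := x₁)
      rw [← hEupd, ← hEupd] at havg
      have hyP : ∀ i, IsStair m (update x₁ l (aPlus (x₁ l) hp) i) :=
        isStair_update' hx₁s l (isStair_aPlus hp (hx₁s l))
      have hyM : ∀ i, IsStair m (update x₁ l (aMinus (x₁ l) hp) i) :=
        isStair_update' hx₁s l (isStair_aMinus hp (hx₁s l))
      have hP := hmin₁ _ hyP
      have hM := hmin₁ _ hyM
      have heq : E (update x₁ l (aPlus (x₁ l) hp)) = E x₁ := by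
        have hEx : E x₁ = et univ univ n (fun i => setInd (stairSet (x₁ i))) := rfl
        rw [← hEx] at havg
        linarith
      have hΛy := hmax₁ _ hyP heq
      rw [hΛupd, S_aPlus] at hΛy
      have hd' : (x₁ l (ixR hp) : ℝ) < x₁ l (ixL hp) := by exact_mod_cast hdl
      linarith
  have hconst : ∀ l, x₁ l = fun _ => x₁ l ⟨0, hm⟩ := fun l =>
    eq_const_of_forall_not_hasDescent hm (hx₁s l).1 (hnd l)
  have hpos : 0 ≤ E x₁ := by
    have hfam : (fun i => setInd (stairSet (x₁ i))) =
        fun i => setInd (stairSet (fun _ : Fin m => x₁ i ⟨0, hm⟩)) := by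
      funext i
      rw [← hconst i]
    change 0 ≤ et univ univ n (fun i => setInd (stairSet (x₁ i)))
    rw [hfam]
    exact et_const_stairs_nonneg hn (fun i => x₁ i ⟨0, hm⟩)
  exact hpos.trans (hmin₁ a ha)

/-! ### The induction -/

/-- **The joint induction of [LiebSahi2021, §3.4] for `Ẽ`**: for every `k` and EVERY grid size `m ≥ k + 2`, `A(k+2)` (symmetric
form) and `C(k+2)`. [this work] -/
theorem et_disjointNonpos_and_stairPos : ∀ k : ℕ,
    (∀ (m : ℕ) (F : Fin (k + 2) → Fin m × Fin m → ℝ) (s t : Fin (k + 2)), s ≠ t → ∀ (b : Fin m → ℕ)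
      (T : Finset (Fin m × Fin m)), k + 2 ≤ m → IsStair m b → Disjoint (stairSet b) T → F s = setInd (stairSet b) →
      F t = setInd T → (∀ i, i ≠ s → i ≠ t → ∃ a, IsStair m a ∧ F i = setInd (stairSet a)) →
      et univ univ (k + 2) F ≤ 0) ∧
    (∀ (m : ℕ) (a : Fin (k + 2) → Fin m → ℕ), k + 2 ≤ m → (∀ i, IsStair m (a i)) →
      0 ≤ et univ univ (k + 2) (fun i => setInd (stairSet (a i))))
  | 0 => by
    have hA : ∀ (m : ℕ) (F : Fin 2 → Fin m × Fin m → ℝ) (s t : Fin 2), s ≠ t → ∀ (b : Fin m → ℕ)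
        (T : Finset (Fin m × Fin m)), 0 + 2 ≤ m → IsStair m b → Disjoint (stairSet b) T → F s = setInd (stairSet b) →
        F t = setInd T → (∀ i, i ≠ s → i ≠ t → ∃ a, IsStair m a ∧ F i = setInd (stairSet a)) →
        et univ univ 2 F ≤ 0 :=
      fun m F s t hst b T _ _ hbT hs ht _ => et_disjoint_nonpos_zero F s t hst b T hbT hs ht
    exact ⟨hA, fun m a hm ha => et_stairPos_of_disjointNonpos (by omega) hm (hA m) a ha⟩
  | k + 1 => by
    obtain ⟨hA, hC⟩ := et_disjointNonpos_and_stairPos k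
    have hA' := et_disjoint_nonpos_succ k hC hA
    exact ⟨hA', fun m a hm ha => et_stairPos_of_disjointNonpos (by omega) hm (hA' m) a ha⟩

/-- **`Ẽ_n ≥ 0` for all staircase families** of the `m × m` grid, `n ≤ m` (Theorem 3.13 for `Ẽ`). [this work] -/
theorem et_stairs_nonneg : ∀ (n m : ℕ) (a : Fin n → Fin m → ℕ), n ≤ m → (∀ i, IsStair m (a i)) →
    0 ≤ et univ univ n (fun i => setInd (stairSet (a i)))
  | 0, _, _, _, _ => by rw [et_zero]
  | 1, m, a, _, _ => by
    rw [et_one]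
    exact div_nonneg (sum_nonneg fun z _ => setInd_nonneg _ _) (by positivity)
  | k + 2, m, a, hm, ha => (et_disjointNonpos_and_stairPos k).2 m a hm ha


/-! ### Transport: down-sets, up-sets, monotone functions -/

/-- `Ẽ_n ≥ 0` for the indicators of any `n ≤ m` DOWN-sets of the `m × m` grid. [this work] -/
theorem et_setInd_nonneg_of_isLowerSet {n : ℕ} (hn : n ≤ m) (L : Fin n → Finset (Fin m × Fin m))
    (hL : ∀ i, IsLowerSet ((L i : Finset (Fin m × Fin m)) : Set (Fin m × Fin m))) :
    0 ≤ et univ univ n (fun i => setInd (L i)) := by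
  choose a ha haL using fun i => exists_stair_eq_of_isLowerSet (L i) (hL i)
  have hfam : (fun i => setInd (L i)) = fun i => setInd (stairSet (a i)) := by
    funext i
    rw [haL i]
  rw [hfam]
  exact et_stairs_nonneg n m a hn ha

/-- `Ẽ_n ≥ 0` for the indicators of any `n ≤ m` UP-sets of the `m × m` grid (reflect both coordinates; `Ẽ` is invariant under
the reflection by `et_comp_equiv`). [this work] -/
theorem et_setInd_nonneg_of_isUpperSet {n : ℕ} (hn : n ≤ m) (U : Fin n → Finset (Fin m × Fin m))
    (hU : ∀ i, IsUpperSet ((U i : Finset (Fin m × Fin m)) : Set (Fin m × Fin m))) :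
    0 ≤ et univ univ n (fun i => setInd (U i)) := by
  let L : Finset (Fin m × Fin m) → Finset (Fin m × Fin m) := fun V => univ.filter fun x => gridRev m x ∈ V
  have hL : ∀ i, IsLowerSet ((L (U i) : Finset (Fin m × Fin m)) : Set (Fin m × Fin m)) := by
    intro i x y hyx hx
    rw [Finset.mem_coe, Finset.mem_filter] at hx ⊢
    exact ⟨mem_univ _, hU i (gridRev_antitone hyx) hx.2⟩
  have hind : ∀ V : Finset (Fin m × Fin m), setInd V ∘ Prod.map Fin.revPerm Fin.revPerm = setInd (L V) := by
    intro V
    funext x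
    simp only [Function.comp_apply, setInd_apply, L, Finset.mem_filter, Finset.mem_univ, true_and]
    rfl
  have key := et_comp_equiv (Fin.revPerm : Fin m ≃ Fin m) (Fin.revPerm : Fin m ≃ Fin m) n (fun i => setInd (U i))
  have hf : (fun i => (fun i => setInd (U i)) i ∘ Prod.map (Fin.revPerm : Fin m ≃ Fin m) (Fin.revPerm : Fin m ≃ Fin m)) =
      fun i => setInd (L (U i)) := by
    funext i
    exact hind (U i)
  rw [← key, hf]
  exact et_setInd_nonneg_of_isLowerSet hn (fun i => L (U i)) hL

/-- Linearity of `Ẽ_n` in one slot over a layer-cake sum `Σ_k c_k·1_{U_k}`. [this work] -/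
theorem et_update_listSum {n : ℕ} (F : Fin n → Fin m × Fin m → ℝ) (i : Fin n)
    (l : List (ℝ × Finset (Fin m × Fin m))) :
    et univ univ n (update F i (l.map fun p => p.1 • setInd p.2).sum) =
      (l.map fun p => p.1 * et univ univ n (update F i (setInd p.2))).sum := by
  induction l with
  | nil => simp [et_update_zero]
  | cons p l ih =>
    rw [List.map_cons, List.sum_cons, List.map_cons, List.sum_cons, ← ih]
    have h := et_update_lin n univ univ F i p.1 1 (setInd p.2) ((l.map fun p => p.1 • setInd p.2).sum)
    rw [one_smul, one_mul] at h
    exact h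

/-- The slot-by-slot layer-cake replacement: if `Ẽ_n ≥ 0` on all `n`-tuples of indicators of up-sets, then `Ẽ_n(f) ≥ 0` whenever
the slots `≥ M` are already such indicators and the others are nonnegative monotone. [this work] -/
theorem et_nonneg_of_indicators_aux (n : ℕ)
    (h : ∀ U : Fin n → Finset (Fin m × Fin m), (∀ i, IsUpperSet ((U i : Finset (Fin m × Fin m)) : Set (Fin m × Fin m))) →
      0 ≤ et univ univ n (fun i => setInd (U i))) :
    ∀ (M : ℕ) (f : Fin n → Fin m × Fin m → ℝ), (∀ i x, 0 ≤ f i x) → (∀ i, Monotone (f i)) →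
      (∀ i : Fin n, M ≤ i.val → ∃ U : Finset (Fin m × Fin m), IsUpperSet ((U : Finset (Fin m × Fin m)) : Set (Fin m × Fin m)) ∧
        f i = setInd U) →
      0 ≤ et univ univ n f
  | 0, f, _, _, hind => by
    choose U hU hfU using fun i => hind i (Nat.zero_le _)
    have hf : f = fun i => setInd (U i) := funext hfU
    rw [hf]
    exact h U hU
  | M + 1, f, hf, hmono, hind => by
    by_cases hM : M < n
    · let i : Fin n := ⟨M, hM⟩
      obtain ⟨l, hl, hfl⟩ := exists_upperSet_decomposition (f i) (hf i) (hmono i)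
      rw [← update_eq_self i f, hfl, et_update_listSum]
      refine List.sum_nonneg fun t ht => ?_
      obtain ⟨p, hp, rfl⟩ := List.mem_map.1 ht
      refine mul_nonneg (hl p hp).1 (et_nonneg_of_indicators_aux n h M _ ?_ ?_ ?_)
      · intro j x
        by_cases hji : j = i
        · subst hji; rw [update_self]; exact setInd_nonneg _ _
        · rw [update_of_ne hji]; exact hf j x
      · intro j
        by_cases hji : j = i
        · subst hji; rw [update_self]; exact monotone_setInd (hl p hp).2
        · rw [update_of_ne hji]; exact hmono j
      · intro j hMj
        by_cases hji : j = i
        · subst hji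
          exact ⟨p.2, (hl p hp).2, by rw [update_self]⟩
        · have hij : M + 1 ≤ j.val := by
            have : j.val ≠ M := fun hv => hji (Fin.ext hv)
            omega
          obtain ⟨U, hU, hjU⟩ := hind j hij
          exact ⟨U, hU, by rw [update_of_ne hji]; exact hjU⟩
    · exact et_nonneg_of_indicators_aux n h M f hf hmono fun i hi => absurd hi (by omega)

/-- **MAIN THEOREM (square grid form).**  For `n ≤ m` and nonnegative monotone `f_0,…,f_{n−1}` on the grid `Fin m × Fin m`
(product order), the without-replacement functional is nonnegative: `Ẽ_n(f_0,…,f_{n−1}) ≥ 0`.  Since the values of `Ẽ_n` are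
the coefficients of Sahi's `E_n` under product weights (`…SahiTwoChainWRCoefficients`), this is the COEFFICIENTWISE form of
Lieb–Sahi's two-dimensional theorem [LiebSahi2021, Thm. 3.7]. [this work] -/
theorem et_nonneg_of_monotone {n : ℕ} (hn : n ≤ m) (f : Fin n → Fin m × Fin m → ℝ) (hf : ∀ i z, 0 ≤ f i z)
    (hmono : ∀ i, Monotone (f i)) : 0 ≤ et univ univ n f :=
  et_nonneg_of_indicators_aux n (fun U hU => et_setInd_nonneg_of_isUpperSet hn U hU) n f hf hmono
    fun i hi => absurd hi (by omega)

end Grid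

end SahiTwoChain

end Summit.CriticalPhenomena.PercolationContinuityZ3.Theorems
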